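import Summits.NavierStokesRegularity.NavierStokesRegularity.Theorems.AdaptedFrequencyConverges.Negative.FalseWithoutDecay

/-!
# The ε-family, I: ε-clocks, the ε-flow (exact Navier–Stokes) and its kernel variances

Negative-side support for crux `AdaptedFrequencyConverges` (stmt-NavierStokesRegularity-10493), cdisprove seat.
TIGHTNESS complement to `adaptedFrequencyConverges_false_without_decay` (`…Negative.FalseWithoutDecay`): replacing the
vorticity clock by `ω_ε(t) = exp(−ε sin log(1−t))` (strain `d_ε = ε d`) gives, for every `ε`, an exact linear
Navier–Stokes flow `u_ε = d_ε D₀x + ½ω_ε e₀×x` (`isClassicalNSSolutionOn_velE`) and the variances `α_ε, β_ε` of its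
adapted Gaussian kernel (ODEs, comparability with `2ν(1−t)` within `e^{±4|ε|}`, smoothness).  Part II
(`…Negative.SmallOscillation`) builds the kernel and refutes the δ-small strengthening of the crux-without-decay.
-/

noncomputable section

namespace Summit.NavierStokesRegularity.NavierStokesRegularity.Theorems.AdaptedFrequencyConverges.Negative

open scoped Matrix InnerProductSpace RealInnerProductSpace Laplacian Topology
open Literature.Analysis.FluidPDE Set Filter MeasureTheory Real intervalIntegral

/-! ### ε-clocks -/

/-- `ω_ε(t) = exp(−ε sin log(1−t))`. [folklore] -/
def ampE (ε t : ℝ) : ℝ := Real.exp (-(ε * Real.sin (Real.log (1 - t))))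

/-- `d_ε = ε d`. [folklore] -/
def strE (ε t : ℝ) : ℝ := ε * str t

/-- `ω_ε > 0`. [folklore] -/
theorem ampE_pos (ε t : ℝ) : 0 < ampE ε t := Real.exp_pos _

/-- `ω_ε ≤ e^{|ε|}`. [folklore] -/
theorem ampE_le (ε t : ℝ) : ampE ε t ≤ Real.exp |ε| := by
  unfold ampE; gcongr
  have h1 := Real.neg_one_le_sin (Real.log (1 - t)); have h2 := Real.sin_le_one (Real.log (1 - t))
  have : |ε * Real.sin (Real.log (1 - t))| ≤ |ε| := by
    rw [abs_mul]; exact mul_le_of_le_one_right (abs_nonneg _) (abs_le.2 ⟨h1, h2⟩)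
  linarith [neg_abs_le (ε * Real.sin (Real.log (1 - t))), this]

/-- `e^{−|ε|} ≤ ω_ε`. [folklore] -/
theorem le_ampE (ε t : ℝ) : Real.exp (-|ε|) ≤ ampE ε t := by
  unfold ampE; gcongr
  have h1 := Real.neg_one_le_sin (Real.log (1 - t)); have h2 := Real.sin_le_one (Real.log (1 - t))
  have : |ε * Real.sin (Real.log (1 - t))| ≤ |ε| := by
    rw [abs_mul]; exact mul_le_of_le_one_right (abs_nonneg _) (abs_le.2 ⟨h1, h2⟩)
  linarith [le_abs_self (ε * Real.sin (Real.log (1 - t))), this]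

/-- the ε-stretching law `ω_ε′ = d_ε ω_ε`. [folklore] -/
theorem hasDerivAt_ampE (ε : ℝ) {t : ℝ} (ht : t < 1) : HasDerivAt (ampE ε) (ampE ε t * strE ε t) t := by
  have h := (((hasDerivAt_log_one_sub ht).sin.const_mul ε).neg).exp
  refine h.congr_deriv ?_
  simp only [Pi.neg_apply, ampE, strE, str, div_eq_mul_inv]
  ring

/-- `ω_ε` is smooth below `1`. [folklore] -/
theorem contDiffAt_ampE (ε : ℝ) {t : ℝ} (ht : t < 1) {n : WithTop ℕ∞} : ContDiffAt ℝ n (ampE ε) t := by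
  have h1 : ContDiffAt ℝ n (fun s : ℝ => 1 - s) t := contDiffAt_const.sub contDiffAt_id
  exact ((contDiffAt_const.mul (h1.log (sub_pos.2 ht).ne').sin).neg).exp

/-- `d_ε` is smooth below `1`. [folklore] -/
theorem contDiffAt_strE (ε : ℝ) {t : ℝ} (ht : t < 1) {n : WithTop ℕ∞} : ContDiffAt ℝ n (strE ε) t :=
  contDiffAt_const.mul (contDiffAt_str ht)

/-- `d_ε′ = ε d′`. [folklore] -/
theorem hasDerivAt_strE (ε : ℝ) {t : ℝ} (ht : t < 1) : HasDerivAt (strE ε) (ε * strDeriv t) t :=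
  (hasDerivAt_str ht).const_mul ε

/-- `ω_ε` is continuous below `1`. [folklore] -/
theorem continuousAt_ampE (ε : ℝ) {t : ℝ} (ht : t < 1) : ContinuousAt (ampE ε) t :=
  (contDiffAt_ampE ε ht (n := 0)).continuousAt

/-- `ω_ε` is measurable. [folklore] -/
theorem measurable_ampE (ε : ℝ) : Measurable (ampE ε) := by unfold ampE; fun_prop

/-! ### the ε-flow: exact Navier–Stokes -/

/-- `u_ε = d_ε D₀x + ½ω_ε e₀×x`. [folklore] -/
def velE (ε t : ℝ) (x : E3) : E3 := linVel (strE ε t) (ampE ε t) x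

/-- pressure coefficients and pressure of the ε-flow. [folklore] -/
def P1E (ε t : ℝ) : ℝ := ε * strDeriv t + strE ε t ^ 2
/-- transverse pressure coefficient of the ε-flow. [folklore] -/
def P2E (ε t : ℝ) : ℝ := -(ε * strDeriv t) / 2 + (strE ε t) ^ 2 / 4 - (ampE ε t) ^ 2 / 4
/-- pressure of the ε-flow. [folklore] -/
def presE (ε t : ℝ) (x : E3) : ℝ := -(1/2) * (P1E ε t * (x 0) ^ 2 + P2E ε t * ((x 1) ^ 2 + (x 2) ^ 2))
/-- its gradient. [folklore] -/
def presGradE (ε t : ℝ) (x : E3) : E3 := !₂[-(P1E ε t * x 0), -(P2E ε t * x 1), -(P2E ε t * x 2)]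

/-- `∇p_ε = presGradE`. [folklore] -/
theorem hasGradientAt_presE (ε t : ℝ) (x : E3) : HasGradientAt (presE ε t) (presGradE ε t x) x := by
  rw [hasGradientAt_iff_hasFDerivAt]
  have h0 := ((crd 0).hasFDerivAt (x := x)).pow 2
  have h1 := ((crd 1).hasFDerivAt (x := x)).pow 2
  have h2 := ((crd 2).hasFDerivAt (x := x)).pow 2
  have h := ((h0.const_mul (P1E ε t)).add ((h1.add h2).const_mul (P2E ε t))).const_mul (-(1/2) : ℝ)
  have h' : HasFDerivAt (presE ε t) _ x :=
    h.congr_of_eventuallyEq (Eventually.of_forall fun y => by simp [presE])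
  refine h'.congr_fderiv ?_
  ext v
  simp [presGradE, PiLp.inner_apply, Fin.sum_univ_three]
  ring

/-- time derivative of `u_ε` at fixed `x`. [folklore] -/
theorem hasDerivAt_velE (ε : ℝ) {t : ℝ} (ht : t < 1) (x : E3) :
    HasDerivAt (fun s => velE ε s x) ((ε * strDeriv t) • D0 x + (ampE ε t * strE ε t / 2) • J x) t :=
  ((hasDerivAt_strE ε ht).smul_const (D0 x)).add (((hasDerivAt_ampE ε ht).div_const 2).smul_const (J x))

/-- **momentum equation for the ε-flow** (any `ν`). [folklore] -/
theorem momentum_velE (ε ν : ℝ) {t : ℝ} (ht : t ∈ Ico (0:ℝ) 1) (x : E3) :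
    timeDerivWithin (Ico 0 1) (velE ε) t x + convect (velE ε t) (velE ε t) x =
      ν • (Δ (velE ε t)) x - gradient (presE ε t) x + (0 : ℝ → E3 → E3) t x := by
  rw [timeDerivWithin_apply, ((hasDerivAt_velE ε ht.2 x).hasDerivWithinAt).derivWithin
    (uniqueDiffOn_Ico 0 1 t ht), show velE ε t = linVel (strE ε t) (ampE ε t) from rfl, convect_linVel,
    laplacian_linVel, (hasGradientAt_presE ε t x).gradient]
  ext i
  fin_cases i <;> simp [presGradE, P1E, P2E] <;> ring

/-- joint smoothness of `u_ε`. [folklore] -/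
theorem contDiffAt_uncurry_velE (ε : ℝ) {t : ℝ} (ht : t < 1) (x : E3) {n : WithTop ℕ∞} :
    ContDiffAt ℝ n (Function.uncurry (velE ε)) (t, x) := by
  have hs : ContDiffAt ℝ n (fun p : ℝ × E3 => strE ε p.1) (t, x) :=
    ContDiffAt.comp (f := Prod.fst) (t, x) (contDiffAt_strE ε ht) contDiffAt_fst
  have ha : ContDiffAt ℝ n (fun p : ℝ × E3 => ampE ε p.1 / 2) (t, x) :=
    (ContDiffAt.comp (f := Prod.fst) (t, x) (contDiffAt_ampE ε ht) contDiffAt_fst).div_const 2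
  have hD : ContDiffAt ℝ n (fun p : ℝ × E3 => D0 p.2) (t, x) :=
    D0.contDiff.contDiffAt.comp (t, x) contDiffAt_snd
  have hJ : ContDiffAt ℝ n (fun p : ℝ × E3 => J p.2) (t, x) :=
    J.contDiff.contDiffAt.comp (t, x) contDiffAt_snd
  exact (hs.smul hD).add (ha.smul hJ)

/-- joint smoothness of `p_ε`. [folklore] -/
theorem contDiffAt_uncurry_presE (ε : ℝ) {t : ℝ} (ht : t < 1) (x : E3) {n : WithTop ℕ∞} :
    ContDiffAt ℝ n (Function.uncurry (presE ε)) (t, x) := by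
  have hc : ∀ i : Fin 3, ContDiffAt ℝ n (fun p : ℝ × E3 => (p.2 i) ^ 2) (t, x) := fun i =>
    (((crd i).contDiff.contDiffAt.comp (t, x) contDiffAt_snd)).pow 2
  have h1 : ContDiffAt ℝ n (fun p : ℝ × E3 => P1E ε p.1) (t, x) := by
    have : ContDiffAt ℝ n (P1E ε) t :=
      (contDiffAt_const.mul (contDiffAt_strDeriv ht)).add ((contDiffAt_strE ε ht).pow 2)
    exact ContDiffAt.comp (f := Prod.fst) (t, x) this contDiffAt_fst
  have h2 : ContDiffAt ℝ n (fun p : ℝ × E3 => P2E ε p.1) (t, x) := by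
    have : ContDiffAt ℝ n (P2E ε) t :=
      (((contDiffAt_const.mul (contDiffAt_strDeriv ht)).neg.div_const 2).add
        (((contDiffAt_strE ε ht).pow 2).div_const 4)).sub (((contDiffAt_ampE ε ht).pow 2).div_const 4)
    exact ContDiffAt.comp (f := Prod.fst) (t, x) this contDiffAt_fst
  exact contDiffAt_const.mul ((h1.mul (hc 0)).add (h2.mul ((hc 1).add (hc 2))))

/-- **the ε-flow is an exact classical Navier–Stokes solution on `[0,1) × ℝ³`** (any `ν`). [folklore] -/
theorem isClassicalNSSolutionOn_velE (ε ν : ℝ) : IsClassicalNSSolutionOn (Ico 0 1) ν 0 (velE ε) (presE ε) where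
  smooth_velocity p hp := (contDiffAt_uncurry_velE ε (mem_prod.1 hp).1.2 p.2).contDiffWithinAt
  smooth_pressure p hp := (contDiffAt_uncurry_presE ε (mem_prod.1 hp).1.2 p.2).contDiffWithinAt
  momentum _ ht x := momentum_velE ε ν ht x
  divFree _ _ x := divergence_linVel _ _ x

/-! ### the ε-kernel -/

/-- `I₁^ε(t) = ∫ₜ¹ ω_ε⁻²`. [folklore] -/
def I1E (ε t : ℝ) : ℝ := ∫ s in t..1, (ampE ε s ^ 2)⁻¹
/-- `I₂^ε(t) = ∫ₜ¹ ω_ε`. [folklore] -/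
def I2E (ε t : ℝ) : ℝ := ∫ s in t..1, ampE ε s

/-- `ω_ε⁻² ≤ e^{2|ε|}`. [folklore] -/
theorem ampE_sq_inv_le (ε t : ℝ) : (ampE ε t ^ 2)⁻¹ ≤ Real.exp (2 * |ε|) := by
  have h0 : 0 < Real.exp (-|ε|) := Real.exp_pos _
  calc (ampE ε t ^ 2)⁻¹ ≤ (Real.exp (-|ε|) ^ 2)⁻¹ :=
        inv_anti₀ (pow_pos h0 2) (pow_le_pow_left₀ h0.le (le_ampE ε t) 2)
    _ = Real.exp (2 * |ε|) := by rw [← Real.exp_nat_mul, ← Real.exp_neg]; norm_num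

/-- `e^{−2|ε|} ≤ ω_ε⁻²`. [folklore] -/
theorem le_ampE_sq_inv (ε t : ℝ) : Real.exp (-(2 * |ε|)) ≤ (ampE ε t ^ 2)⁻¹ := by
  calc Real.exp (-(2 * |ε|)) = (Real.exp |ε| ^ 2)⁻¹ := by
        rw [← Real.exp_nat_mul, ← Real.exp_neg]; norm_num
    _ ≤ (ampE ε t ^ 2)⁻¹ :=
        inv_anti₀ (pow_pos (ampE_pos ε t) 2) (pow_le_pow_left₀ (ampE_pos ε t).le (ampE_le ε t) 2)

/-- interval integrability of `ω_ε`. [folklore] -/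
theorem intervalIntegrable_ampE (ε a b : ℝ) : IntervalIntegrable (ampE ε) volume a b := by
  refine (intervalIntegrable_const (c := Real.exp |ε|)).mono_fun' (measurable_ampE ε).aestronglyMeasurable ?_
  exact Eventually.of_forall fun s => by
    show ‖ampE ε s‖ ≤ Real.exp |ε|
    rw [Real.norm_of_nonneg (ampE_pos ε s).le]; exact ampE_le ε s

/-- interval integrability of `ω_ε⁻²`. [folklore] -/
theorem intervalIntegrable_ampE_sq_inv (ε a b : ℝ) :
    IntervalIntegrable (fun s => (ampE ε s ^ 2)⁻¹) volume a b := by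
  refine (intervalIntegrable_const (c := Real.exp (2 * |ε|))).mono_fun'
    ((measurable_ampE ε).pow_const 2).inv.aestronglyMeasurable ?_
  exact Eventually.of_forall fun s => by
    show ‖(ampE ε s ^ 2)⁻¹‖ ≤ Real.exp (2 * |ε|)
    rw [Real.norm_of_nonneg (inv_nonneg.2 (sq_nonneg _))]; exact ampE_sq_inv_le ε s

/-- `(I₂^ε)′ = −ω_ε`. [folklore] -/
theorem hasDerivAt_I2E (ε : ℝ) {t : ℝ} (ht : t < 1) : HasDerivAt (I2E ε) (-ampE ε t) t := by
  unfold I2E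
  have hc : ContinuousOn (ampE ε) (Iio 1) := fun s hs => (continuousAt_ampE ε hs).continuousWithinAt
  exact integral_hasDerivAt_left (intervalIntegrable_ampE ε t 1)
    (hc.stronglyMeasurableAtFilter isOpen_Iio t ht) (continuousAt_ampE ε ht)

/-- `(I₁^ε)′ = −ω_ε⁻²`. [folklore] -/
theorem hasDerivAt_I1E (ε : ℝ) {t : ℝ} (ht : t < 1) : HasDerivAt (I1E ε) (-(ampE ε t ^ 2)⁻¹) t := by
  unfold I1E
  have hc : ContinuousOn (fun s => (ampE ε s ^ 2)⁻¹) (Iio 1) := fun s hs =>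
    (((continuousAt_ampE ε hs).pow 2).inv₀ (pow_pos (ampE_pos ε s) 2).ne').continuousWithinAt
  exact integral_hasDerivAt_left (intervalIntegrable_ampE_sq_inv ε t 1)
    (hc.stronglyMeasurableAtFilter isOpen_Iio t ht)
    (((continuousAt_ampE ε ht).pow 2).inv₀ (pow_pos (ampE_pos ε t) 2).ne')

/-- bounds for `I₂^ε`. [folklore] -/
theorem I2E_bounds (ε : ℝ) {t : ℝ} (ht : t ≤ 1) :
    Real.exp (-|ε|) * (1 - t) ≤ I2E ε t ∧ I2E ε t ≤ Real.exp |ε| * (1 - t) := by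
  constructor
  · have := intervalIntegral.integral_mono_on ht (intervalIntegrable_const (c := Real.exp (-|ε|)))
      (intervalIntegrable_ampE ε t 1) (fun s _ => le_ampE ε s)
    simpa [I2E, mul_comm] using this
  · have := intervalIntegral.integral_mono_on ht (intervalIntegrable_ampE ε t 1)
      (intervalIntegrable_const (c := Real.exp |ε|)) (fun s _ => ampE_le ε s)
    simpa [I2E, mul_comm] using this

/-- bounds for `I₁^ε`. [folklore] -/
theorem I1E_bounds (ε : ℝ) {t : ℝ} (ht : t ≤ 1) :
    Real.exp (-(2 * |ε|)) * (1 - t) ≤ I1E ε t ∧ I1E ε t ≤ Real.exp (2 * |ε|) * (1 - t) := by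
  constructor
  · have := intervalIntegral.integral_mono_on ht (intervalIntegrable_const (c := Real.exp (-(2 * |ε|))))
      (intervalIntegrable_ampE_sq_inv ε t 1) (fun s _ => le_ampE_sq_inv ε s)
    simpa [I1E, mul_comm] using this
  · have := intervalIntegral.integral_mono_on ht (intervalIntegrable_ampE_sq_inv ε t 1)
      (intervalIntegrable_const (c := Real.exp (2 * |ε|))) (fun s _ => ampE_sq_inv_le ε s)
    simpa [I1E, mul_comm] using this

/-- `I₂^ε` is smooth on `(−∞,1)`. [folklore] -/
theorem contDiffOn_I2E (ε : ℝ) : ContDiffOn ℝ (⊤ : ℕ∞) (I2E ε) (Iio 1) := by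
  refine (contDiffOn_infty_iff_deriv_of_isOpen isOpen_Iio).2 ⟨?_, ?_⟩
  · exact fun t ht => (hasDerivAt_I2E ε ht).differentiableAt.differentiableWithinAt
  · have : ContDiffOn ℝ (⊤ : ℕ∞) (fun t => -ampE ε t) (Iio 1) := fun t ht =>
      (contDiffAt_ampE ε ht).neg.contDiffWithinAt
    exact this.congr fun t ht => (hasDerivAt_I2E ε ht).deriv

/-- `I₁^ε` is smooth on `(−∞,1)`. [folklore] -/
theorem contDiffOn_I1E (ε : ℝ) : ContDiffOn ℝ (⊤ : ℕ∞) (I1E ε) (Iio 1) := by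
  refine (contDiffOn_infty_iff_deriv_of_isOpen isOpen_Iio).2 ⟨?_, ?_⟩
  · exact fun t ht => (hasDerivAt_I1E ε ht).differentiableAt.differentiableWithinAt
  · have : ContDiffOn ℝ (⊤ : ℕ∞) (fun t => -(ampE ε t ^ 2)⁻¹) (Iio 1) := fun t ht =>
      (((contDiffAt_ampE ε ht).pow 2).inv (pow_pos (ampE_pos ε t) 2).ne').neg.contDiffWithinAt
    exact this.congr fun t ht => (hasDerivAt_I1E ε ht).deriv

/-- axial variance of the ε-kernel. [folklore] -/
def varAE (ν ε t : ℝ) : ℝ := 2 * ν * ampE ε t ^ 2 * I1E ε t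
/-- transverse variance of the ε-kernel. [folklore] -/
def varBE (ν ε t : ℝ) : ℝ := 2 * ν * (ampE ε t)⁻¹ * I2E ε t

/-- `α_ε′ = 2d_ε α_ε − 2ν`. [folklore] -/
theorem hasDerivAt_varAE (ν ε : ℝ) {t : ℝ} (ht : t < 1) :
    HasDerivAt (varAE ν ε) (2 * strE ε t * varAE ν ε t - 2 * ν) t := by
  have h := (((hasDerivAt_ampE ε ht).pow 2).const_mul (2 * ν)).mul (hasDerivAt_I1E ε ht)
  refine h.congr_deriv ?_
  have ha : ampE ε t ≠ 0 := (ampE_pos ε t).ne'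
  simp only [varAE, Pi.pow_apply]
  field_simp
  ring

/-- `β_ε′ = −d_ε β_ε − 2ν`. [folklore] -/
theorem hasDerivAt_varBE (ν ε : ℝ) {t : ℝ} (ht : t < 1) :
    HasDerivAt (varBE ν ε) (-(strE ε t) * varBE ν ε t - 2 * ν) t := by
  have ha : ampE ε t ≠ 0 := (ampE_pos ε t).ne'
  have h := (((hasDerivAt_ampE ε ht).inv ha).const_mul (2 * ν)).mul (hasDerivAt_I2E ε ht)
  refine h.congr_deriv ?_
  simp only [varBE, Pi.inv_apply]
  field_simp
  ring

/-- `α_ε` is comparable to `2ν(1−t)` within `e^{±4|ε|}`. [folklore] -/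
theorem varAE_bounds {ν : ℝ} (hν : 0 ≤ ν) (ε : ℝ) {t : ℝ} (ht : t ≤ 1) :
    2 * ν * Real.exp (-(4 * |ε|)) * (1 - t) ≤ varAE ν ε t ∧
      varAE ν ε t ≤ 2 * ν * Real.exp (4 * |ε|) * (1 - t) := by
  obtain ⟨h1, h2⟩ := I1E_bounds ε ht
  have ha1 := ampE_le ε t
  have ha2 := le_ampE ε t
  have ha0 : 0 ≤ ampE ε t := (ampE_pos ε t).le
  have hI : 0 ≤ I1E ε t := h1.trans' (mul_nonneg (Real.exp_pos _).le (sub_nonneg.2 ht))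
  have he : 0 ≤ Real.exp (-|ε|) := (Real.exp_pos _).le
  have e1 : Real.exp (-(4 * |ε|)) = Real.exp (-|ε|) ^ 2 * Real.exp (-(2 * |ε|)) := by
    rw [← Real.exp_nat_mul, ← Real.exp_add]; ring_nf
  have e2 : Real.exp (4 * |ε|) = Real.exp |ε| ^ 2 * Real.exp (2 * |ε|) := by
    rw [← Real.exp_nat_mul, ← Real.exp_add]; ring_nf
  constructor
  · rw [e1, varAE]
    calc 2 * ν * (Real.exp (-|ε|) ^ 2 * Real.exp (-(2 * |ε|))) * (1 - t)
        = 2 * ν * Real.exp (-|ε|) ^ 2 * (Real.exp (-(2 * |ε|)) * (1 - t)) := by ring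
      _ ≤ 2 * ν * ampE ε t ^ 2 * I1E ε t := by gcongr
  · rw [e2, varAE]
    calc 2 * ν * ampE ε t ^ 2 * I1E ε t ≤ 2 * ν * Real.exp |ε| ^ 2 * (Real.exp (2 * |ε|) * (1 - t)) := by
          gcongr
      _ = 2 * ν * (Real.exp |ε| ^ 2 * Real.exp (2 * |ε|)) * (1 - t) := by ring

/-- `β_ε` is comparable to `2ν(1−t)` within `e^{±2|ε|}`. [folklore] -/
theorem varBE_bounds {ν : ℝ} (hν : 0 ≤ ν) (ε : ℝ) {t : ℝ} (ht : t ≤ 1) :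
    2 * ν * Real.exp (-(2 * |ε|)) * (1 - t) ≤ varBE ν ε t ∧
      varBE ν ε t ≤ 2 * ν * Real.exp (2 * |ε|) * (1 - t) := by
  obtain ⟨h1, h2⟩ := I2E_bounds ε ht
  have ha1 : (ampE ε t)⁻¹ ≤ Real.exp |ε| := by
    calc (ampE ε t)⁻¹ ≤ (Real.exp (-|ε|))⁻¹ := inv_anti₀ (Real.exp_pos _) (le_ampE ε t)
      _ = Real.exp |ε| := by rw [← Real.exp_neg, neg_neg]
  have ha2 : Real.exp (-|ε|) ≤ (ampE ε t)⁻¹ := by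
    calc Real.exp (-|ε|) = (Real.exp |ε|)⁻¹ := by rw [← Real.exp_neg]
      _ ≤ (ampE ε t)⁻¹ := inv_anti₀ (ampE_pos ε t) (ampE_le ε t)
  have ha0 : 0 ≤ (ampE ε t)⁻¹ := inv_nonneg.2 (ampE_pos ε t).le
  have hI : 0 ≤ I2E ε t := h1.trans' (mul_nonneg (Real.exp_pos _).le (sub_nonneg.2 ht))
  have he : 0 ≤ Real.exp (-|ε|) := (Real.exp_pos _).le
  have e1 : Real.exp (-(2 * |ε|)) = Real.exp (-|ε|) * Real.exp (-|ε|) := by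
    rw [← Real.exp_add]; ring_nf
  have e2 : Real.exp (2 * |ε|) = Real.exp |ε| * Real.exp |ε| := by
    rw [← Real.exp_add]; ring_nf
  constructor
  · rw [e1, varBE]
    calc 2 * ν * (Real.exp (-|ε|) * Real.exp (-|ε|)) * (1 - t)
        = 2 * ν * Real.exp (-|ε|) * (Real.exp (-|ε|) * (1 - t)) := by ring
      _ ≤ 2 * ν * (ampE ε t)⁻¹ * I2E ε t := by gcongr
  · rw [e2, varBE]
    calc 2 * ν * (ampE ε t)⁻¹ * I2E ε t ≤ 2 * ν * Real.exp |ε| * (Real.exp |ε| * (1 - t)) := by gcongr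
      _ = 2 * ν * (Real.exp |ε| * Real.exp |ε|) * (1 - t) := by ring

/-- `α_ε > 0` below `1`. [folklore] -/
theorem varAE_pos {ν : ℝ} (hν : 0 < ν) (ε : ℝ) {t : ℝ} (ht : t < 1) : 0 < varAE ν ε t :=
  lt_of_lt_of_le (by have := Real.exp_pos (-(4 * |ε|)); have := sub_pos.2 ht; positivity)
    (varAE_bounds hν.le ε ht.le).1

/-- `β_ε > 0` below `1`. [folklore] -/
theorem varBE_pos {ν : ℝ} (hν : 0 < ν) (ε : ℝ) {t : ℝ} (ht : t < 1) : 0 < varBE ν ε t :=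
  lt_of_lt_of_le (by have := Real.exp_pos (-(2 * |ε|)); have := sub_pos.2 ht; positivity)
    (varBE_bounds hν.le ε ht.le).1

/-- `α_ε` is smooth on `(−∞,1)`. [folklore] -/
theorem contDiffOn_varAE (ν ε : ℝ) : ContDiffOn ℝ (⊤ : ℕ∞) (varAE ν ε) (Iio 1) := by
  have h1 : ContDiffOn ℝ (⊤ : ℕ∞) (fun t => 2 * ν * ampE ε t ^ 2) (Iio 1) := fun t ht =>
    (contDiffAt_const.mul ((contDiffAt_ampE ε ht).pow 2)).contDiffWithinAt
  exact h1.mul (contDiffOn_I1E ε)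

/-- `β_ε` is smooth on `(−∞,1)`. [folklore] -/
theorem contDiffOn_varBE (ν ε : ℝ) : ContDiffOn ℝ (⊤ : ℕ∞) (varBE ν ε) (Iio 1) := by
  have h1 : ContDiffOn ℝ (⊤ : ℕ∞) (fun t => 2 * ν * (ampE ε t)⁻¹) (Iio 1) := fun t ht =>
    (contDiffAt_const.mul ((contDiffAt_ampE ε ht).inv (ampE_pos ε t).ne')).contDiffWithinAt
  exact h1.mul (contDiffOn_I2E ε)


end Summit.NavierStokesRegularity.NavierStokesRegularity.Theorems.AdaptedFrequencyConverges.Negative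

end
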